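import Summits.Parity.GeneralizedHardyLittlewood.Theorems.PrimeLevelFamEdgeMomentsBeyondDiagonalLayersWeightTail
import Summits.Parity.GeneralizedHardyLittlewood.Theorems.PrimeLevelFamEdgeMomentsBeyondDiagonalLayersLayerFromOrderBound
import HarnessLib

/-!
# Route `PrimeLevelFamEdge`, crux K_A `MomentsBeyondDiagonal` (stmt-Parity-20007), line «petersson_layers» v4:
# `stub_farP` REDUCED TO THE EFFECTIVE BOX — per-order power savings on `d₁n₁'·d₂n₂' ≤ ⌈q̂^{2+η}⌉` suffice

Third layer of the top-down assembly (after `…LayersBandFromLayerBound`, `…LayersLayerFromOrderBound`), consuming step A1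
(`…LayersWeightTail{Term,}`): the AFE-weight tail of `I_{ij}(r)` beyond `Y = ⌈q̂^{2+η}⌉` is `≪ q̂^{−δ}/r` once the decay
exponent is taken `A = 2 + (6+δ)/η`, so in `subFar_rhoP_of_order_bound` the full order sums `I_{ij}(r)` may be replaced by their
EFFECTIVE-BOX parts:
* `qhat_sq_le`: `q̂² ≤ q`; `logFactor_pow_le_qhat`: `((1+log q̂)(1+2log q))^k ≤ C_k q̂` (`q ≥ 64`);
* `tail_scale_le`: `(q̂^{Δ'})² q̂⁴ (q̂²/⌈q̂^{2+η}⌉)^{(6+δ)/η}/(qr) ≤ q̂⁻¹ q̂^{−δ}/r` (`q ≥ 64`, `0 < Δ' ≤ 3/2`);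
* **`subFar_rhoP_of_effective_order_bound`**: `SubFar rhoP` (the registered signature of `stub_farP`) ⟸ on a window
  `(1, Δ₀] ⊆ (1, 3/2]`, for every admissible `P` and `Δ'`: ONE `δ > 0` and ONE `η > 0` and, per order `(i,j)`, constants `A, q₀`
  with `‖I_{ij}^{≤Y}(r)‖ ≤ A q̂^{−δ}/r` on the print band `⌊q̂^{ρ_P}⌋ < r ≤ ⌊q̂^{ρ_W}⌋`, `Y = ⌈q̂^{2+η}⌉` (primes `q ≥ q₀`).
In the effective box the Bessel argument is `4π√(ab)/(qr) ≤ 4π M q̂^{1+η/2}/(qr) ≪ 1` throughout the band, so the separated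
Taylor forms (`…LayersTruncatedBlock`, `…LayersTruncationError`) and the bilinear bounds (`…LayersBlockFourierBound`, conditional
`…LayersBlockPascadiBound`) apply; that bookkeeping (census A2–A6) is NOT done here. Proof only (def-free helper); K_A NOT proved;
nothing about Landau–Siegel zeros.
-/

noncomputable section

open scoped Real Nat
open Complex Finset Polynomial MeasureTheory
open Literature.NumberTheory.LFunctions

namespace Summit.Parity.GeneralizedHardyLittlewood.Theorems.MomentsBeyondDiagonal.Layers

open Summit.Parity.GeneralizedHardyLittlewood.Theorems.PrimeLevelFamEdgeIdeaDeltas.PeterssonLayers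
open Summit.Parity.GeneralizedHardyLittlewood.Theorems.MomentsBeyondDiagonal.TwoOrderAFE
  (one_add_two_log_le one_add_log_pow_le_rpow)

/-! ## §1. Scales -/

/-- `q̂² ≤ q` (`q̂ = √q/(2π)`, `4π² ≥ 1`). [folklore] -/
theorem qhat_sq_le (q : ℕ) : KMV2000.qhat q ^ 2 ≤ (q : ℝ) := by
  have hq : (0 : ℝ) ≤ q := Nat.cast_nonneg q
  unfold KMV2000.qhat
  rw [div_pow, Real.sq_sqrt hq, div_le_iff₀ (by positivity)]
  have h1 : (1 : ℝ) ≤ (2 * π) ^ 2 := by nlinarith [Real.pi_gt_three]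
  calc (q : ℝ) = (q : ℝ) * 1 := (mul_one _).symm
    _ ≤ (q : ℝ) * (2 * π) ^ 2 := mul_le_mul_of_nonneg_left h1 hq

/-- **The log factor is sub-power**: `((1 + log q̂)(1 + 2 log q))^k ≤ C_k · q̂` for `q ≥ 64` (`1 + 2 log q ≤ 9(1 + log q̂)`,
`(1 + log x)^{2k} ≤ (1 + 2k)^{2k} x` for `x ≥ 1`). [folklore] -/
theorem logFactor_pow_le_qhat (k : ℕ) :
    ∃ C : ℝ, 0 ≤ C ∧ ∀ (q : ℕ) [NeZero q], 64 ≤ q →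
      ((1 + Real.log (KMV2000.qhat q)) * (1 + 2 * Real.log q)) ^ k ≤ C * KMV2000.qhat q := by
  rcases Nat.eq_zero_or_pos k with rfl | hk
  · refine ⟨1, zero_le_one, fun q _ hq ↦ ?_⟩
    simpa using (one_lt_qhat hq).le
  set ε : ℝ := 1 / (2 * k) with hεdef
  have hε : 0 < ε := by rw [hεdef]; positivity
  refine ⟨9 ^ k * (1 + ε⁻¹) ^ (2 * k), by positivity, fun q _ hq ↦ ?_⟩
  have hqh1 : 1 < KMV2000.qhat q := one_lt_qhat hq
  have hL0 : 0 ≤ 1 + Real.log (KMV2000.qhat q) := by linarith [Real.log_nonneg hqh1.le]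
  have hlq : 0 ≤ Real.log (q : ℝ) := Real.log_nonneg (by exact_mod_cast (le_trans (by norm_num) hq : 1 ≤ q))
  have h9 := one_add_two_log_le (q := q) hq
  have hpow := one_add_log_pow_le_rpow hε (2 * k) hqh1.le
  have hk0 : (k : ℝ) ≠ 0 := by exact_mod_cast hk.ne'
  have hexp : ε * ((2 * k : ℕ) : ℝ) = 1 := by
    rw [hεdef]; push_cast; field_simp
  rw [hexp, Real.rpow_one] at hpow
  calc ((1 + Real.log (KMV2000.qhat q)) * (1 + 2 * Real.log q)) ^ k
      ≤ ((1 + Real.log (KMV2000.qhat q)) * (9 * (1 + Real.log (KMV2000.qhat q)))) ^ k :=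
        pow_le_pow_left₀ (mul_nonneg hL0 (by linarith)) (mul_le_mul_of_nonneg_left h9 hL0) k
    _ = 9 ^ k * (1 + Real.log (KMV2000.qhat q)) ^ (2 * k) := by
        rw [pow_mul, ← mul_pow]
        congr 1
        ring
    _ ≤ 9 ^ k * ((1 + ε⁻¹) ^ (2 * k) * KMV2000.qhat q) := mul_le_mul_of_nonneg_left hpow (by positivity)
    _ = 9 ^ k * (1 + ε⁻¹) ^ (2 * k) * KMV2000.qhat q := by ring

/-- **The tail scale**: for `q ≥ 64`, `Δ' ≤ 3/2`, `δ, η > 0`, `r ≥ 1` and `Y = ⌈q̂^{2+η}⌉`: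
`(q̂^{Δ'})² · q̂⁴ · (q̂²/Y)^{(6+δ)/η} / (qr) ≤ q̂⁻¹ · q̂^{−δ} · r⁻¹` (`q̂² ≤ q`, `q̂²/Y ≤ q̂^{−η}`, `2Δ' ≤ 3`; only `Δ' ≤ 3/2` is used). [folklore] -/
theorem tail_scale_le {q : ℕ} [NeZero q] (hq : 64 ≤ q) {Δ' δ η : ℝ} (hΔ' : Δ' ≤ 3 / 2) (hδ : 0 < δ)
    (hη : 0 < η) {r : ℕ} (hr : r ≠ 0) :
    (KMV2000.qhat q ^ Δ') ^ 2 * KMV2000.qhat q ^ 4 *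
        (KMV2000.qhat q ^ 2 / ((⌈KMV2000.qhat q ^ (2 + η)⌉₊ : ℕ) : ℝ)) ^ ((6 + δ) / η) / ((q : ℝ) * r) ≤
      KMV2000.qhat q ^ (-1 : ℝ) * KMV2000.qhat q ^ (-δ) * ((r : ℝ))⁻¹ := by
  have hqh1 : 1 < KMV2000.qhat q := one_lt_qhat hq
  have hqh0 : 0 < KMV2000.qhat q := zero_lt_one.trans hqh1
  have hr0 : (0 : ℝ) < r := by exact_mod_cast Nat.pos_of_ne_zero hr
  have hq0 : (0 : ℝ) < q := by exact_mod_cast lt_of_lt_of_le (by norm_num : 0 < 64) hq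
  set x : ℝ := KMV2000.qhat q with hx
  -- `q̂² / Y ≤ q̂^{-η}`
  have hYge : x ^ (2 + η) ≤ ((⌈x ^ (2 + η)⌉₊ : ℕ) : ℝ) := Nat.le_ceil _
  have hYpos : 0 < ((⌈x ^ (2 + η)⌉₊ : ℕ) : ℝ) := lt_of_lt_of_le (Real.rpow_pos_of_pos hqh0 _) hYge
  have hratio : x ^ 2 / ((⌈x ^ (2 + η)⌉₊ : ℕ) : ℝ) ≤ x ^ (-η) := by
    rw [div_le_iff₀ hYpos]
    calc x ^ 2 = x ^ (-η) * x ^ (2 + η) := by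
          rw [← Real.rpow_natCast x 2, ← Real.rpow_add hqh0]; congr 1; push_cast; ring
      _ ≤ x ^ (-η) * ((⌈x ^ (2 + η)⌉₊ : ℕ) : ℝ) := mul_le_mul_of_nonneg_left hYge (Real.rpow_nonneg hqh0.le _)
  have hA0 : 0 ≤ (6 + δ) / η := by positivity
  have hdec : (x ^ 2 / ((⌈x ^ (2 + η)⌉₊ : ℕ) : ℝ)) ^ ((6 + δ) / η) ≤ x ^ (-(6 + δ)) := by
    calc (x ^ 2 / ((⌈x ^ (2 + η)⌉₊ : ℕ) : ℝ)) ^ ((6 + δ) / η) ≤ (x ^ (-η)) ^ ((6 + δ) / η) :=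
          Real.rpow_le_rpow (by positivity) hratio hA0
      _ = x ^ (-(6 + δ)) := by
          rw [← Real.rpow_mul hqh0.le]
          congr 1
          have hη0 : η ≠ 0 := hη.ne'
          field_simp
  -- `(q̂^{Δ'})² ≤ q̂³`
  have hM2 : (x ^ Δ') ^ 2 ≤ x ^ (3 : ℝ) := by
    rw [← Real.rpow_natCast (x ^ Δ') 2, ← Real.rpow_mul hqh0.le]
    exact Real.rpow_le_rpow_of_exponent_le hqh1.le (by push_cast; linarith)
  -- `q̂⁴ / q ≤ q̂²`
  have hq4 : x ^ 4 / (q : ℝ) ≤ x ^ (2 : ℝ) := by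
    rw [Real.rpow_two, div_le_iff₀ hq0]
    have h2 : x ^ 2 ≤ (q : ℝ) := by rw [hx]; exact qhat_sq_le q
    have h4 : x ^ 4 = x ^ 2 * x ^ 2 := by ring
    rw [h4]
    exact mul_le_mul_of_nonneg_left h2 (pow_nonneg hqh0.le 2)
  -- assemble
  have e : (x ^ Δ') ^ 2 * x ^ 4 * (x ^ 2 / ((⌈x ^ (2 + η)⌉₊ : ℕ) : ℝ)) ^ ((6 + δ) / η) / ((q : ℝ) * r) =
      (x ^ Δ') ^ 2 * (x ^ 4 / (q : ℝ)) * (x ^ 2 / ((⌈x ^ (2 + η)⌉₊ : ℕ) : ℝ)) ^ ((6 + δ) / η) * ((r : ℝ))⁻¹ := by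
    ring
  rw [e]
  have htarget : x ^ (3 : ℝ) * x ^ (2 : ℝ) * x ^ (-(6 + δ)) = x ^ (-1 : ℝ) * x ^ (-δ) := by
    rw [← Real.rpow_add hqh0, ← Real.rpow_add hqh0, ← Real.rpow_add hqh0]
    congr 1
    ring
  have hD0 : 0 ≤ (x ^ 2 / ((⌈x ^ (2 + η)⌉₊ : ℕ) : ℝ)) ^ ((6 + δ) / η) := Real.rpow_nonneg (by positivity) _
  have step : (x ^ Δ') ^ 2 * (x ^ 4 / (q : ℝ)) * (x ^ 2 / ((⌈x ^ (2 + η)⌉₊ : ℕ) : ℝ)) ^ ((6 + δ) / η) ≤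
      x ^ (3 : ℝ) * x ^ (2 : ℝ) * x ^ (-(6 + δ)) :=
    mul_le_mul (mul_le_mul hM2 hq4 (div_nonneg (pow_nonneg hqh0.le 4) hq0.le) (Real.rpow_nonneg hqh0.le _)) hdec hD0
      (mul_nonneg (Real.rpow_nonneg hqh0.le _) (Real.rpow_nonneg hqh0.le _))
  calc (x ^ Δ') ^ 2 * (x ^ 4 / (q : ℝ)) * (x ^ 2 / ((⌈x ^ (2 + η)⌉₊ : ℕ) : ℝ)) ^ ((6 + δ) / η) * ((r : ℝ))⁻¹
      ≤ x ^ (3 : ℝ) * x ^ (2 : ℝ) * x ^ (-(6 + δ)) * ((r : ℝ))⁻¹ :=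
        mul_le_mul_of_nonneg_right step (by positivity)
    _ = x ^ (-1 : ℝ) * x ^ (-δ) * ((r : ℝ))⁻¹ := by rw [htarget]

/-! ## §2. `stub_farP` from per-order power savings on the effective box -/

/-- **`stub_farP`'s signature `SubFar rhoP` from PER-ORDER POWER SAVINGS ON THE EFFECTIVE BOX.** If on a window
`(1, Δ₀] ⊆ (1, 3/2]`, for every admissible `P` and every `Δ'` in the window there are ONE `δ > 0` and ONE `η > 0` such that for
every order `(i, j)` there are `A, q₀` with
`‖Σ_{d₁,d₂,m₁',n₁',m₂'} Σ_{n₂' : d₁n₁'d₂n₂' ≤ ⌈q̂^{2+η}⌉} [(d₁n₁'d₂n₂')^{−1/2} W_{ij}] [x x K_r-kernel(m₁'n₁', m₂'n₂')]‖ ≤ A q̂^{−δ}/r`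
for all primes `q ≥ q₀` (`q̂^{Δ'} ∉ ℕ`) and all layers `⌊q̂^{ρ_P}⌋ < r ≤ ⌊q̂^{ρ_W}⌋`, then `SubFar rhoP`
(`subFar_rhoP_of_order_bound` + the A1 tail `norm_orderTail_le` at decay exponent `2 + (6+δ)/η`). [folklore] -/
theorem subFar_rhoP_of_effective_order_bound {Δ₀ : ℝ} (hΔ₀ : 1 < Δ₀) (hΔ₀' : Δ₀ ≤ 3 / 2)
    (h : ∀ P : ℝ[X], KMV2000.Admissible P → ∀ Δ' : ℝ, 1 < Δ' → Δ' ≤ Δ₀ →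
      ∃ δ η : ℝ, 0 < δ ∧ 0 < η ∧ ∀ i j : ℕ, ∃ A : ℝ, ∃ q₀ : ℕ, ∀ (q : ℕ) [NeZero q], q.Prime → q₀ ≤ q →
        (∀ n : ℕ, (n : ℝ) ≠ KMV2000.qhat q ^ Δ') →
        ∀ r ∈ Icc (layerCount q rhoP Δ' + 1) (layerCount q rhoWeil Δ'),
          ‖∑ d₁ ∈ Icc 1 ⌊KMV2000.qhat q ^ Δ'⌋₊, ∑ d₂ ∈ Icc 1 ⌊KMV2000.qhat q ^ Δ'⌋₊,
            ∑ m₁ ∈ Icc 1 (⌊KMV2000.qhat q ^ Δ'⌋₊ / d₁), ∑ n₁ ∈ Icc 1 (q ^ 2 / d₁),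
            ∑ m₂ ∈ Icc 1 (⌊KMV2000.qhat q ^ Δ'⌋₊ / d₂),
            ∑ n₂ ∈ (Icc 1 (q ^ 2 / d₂)).filter (fun n₂ ↦ d₁ * n₁ * (d₂ * n₂) ≤ ⌈KMV2000.qhat q ^ (2 + η)⌉₊),
              ((((((d₁ * n₁ : ℕ) : ℝ) * ((d₂ * n₂ : ℕ) : ℝ)) ^ (-(1 / 2 : ℝ)) : ℝ) : ℂ) *
                  afeW (KMV2000.qhat q) i j (d₁ * n₁) (d₂ * n₂)) *
                ((KMV2000.mollifierCoeff P (KMV2000.qhat q ^ Δ') (d₁ * m₁) : ℂ) *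
                  (KMV2000.mollifierCoeff P (KMV2000.qhat q ^ Δ') (d₂ * m₂) : ℂ) *
                  layerKernel q r (m₁ * n₁) (m₂ * n₂))‖ ≤
            A * KMV2000.qhat q ^ (-δ) * ((r : ℝ))⁻¹) :
    SubFar rhoP := by
  refine subFar_rhoP_of_order_bound hΔ₀ fun P hP Δ' h1 h2 ↦ ?_
  obtain ⟨δ, η, hδ, hη, hij⟩ := h P hP Δ' h1 h2
  have h32 : Δ' ≤ 3 / 2 := h2.trans hΔ₀'
  have h0 : 0 < Δ' := by linarith
  refine ⟨δ, hδ, fun i j ↦ ?_⟩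
  obtain ⟨A, q₀, hA⟩ := hij i j
  -- the tail constants at decay exponent `2 + (6+δ)/η`
  have hAexp : (2 : ℝ) ≤ 2 + (6 + δ) / η := by linarith [div_nonneg (by linarith : (0 : ℝ) ≤ 6 + δ) hη.le]
  obtain ⟨Ct, hCt0, hCt⟩ := norm_orderTail_le P i j hAexp
  obtain ⟨Cl, hCl0, hCl⟩ := logFactor_pow_le_qhat (i + j)
  refine ⟨A + Ct * Cl, max q₀ 64, fun q _ hq hq₀ hM r hr ↦ ?_⟩
  have hq₀' : q₀ ≤ q := le_trans (le_max_left _ _) hq₀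
  have h64 : 64 ≤ q := le_trans (le_max_right _ _) hq₀
  have hqh1 : 1 < KMV2000.qhat q := one_lt_qhat h64
  have hqh0 : 0 < KMV2000.qhat q := zero_lt_one.trans hqh1
  have hr1 : 1 ≤ r := by
    have := (mem_Icc.mp hr).1
    omega
  have hr0 : r ≠ 0 := by omega
  have hrpos : (0 : ℝ) < r := by exact_mod_cast hr1
  set Y : ℕ := ⌈KMV2000.qhat q ^ (2 + η)⌉₊ with hY
  have hY1 : 1 ≤ Y := Nat.one_le_iff_ne_zero.mpr (Nat.pos_iff_ne_zero.mp (Nat.ceil_pos.mpr (Real.rpow_pos_of_pos hqh0 _)))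
  have hmain := hA q hq hq₀' hM r hr
  have htail := hCt q h64 Δ' h0 r hr0 Y hY1
  have hscale := tail_scale_le h64 h32 hδ hη hr0
  have hlog := hCl q h64
  rw [orderSum_eq_main_add_tail q P Δ' i j r Y]
  refine (norm_add_le _ _).trans ?_
  have hexp : 2 + (6 + δ) / η - 2 = (6 + δ) / η := by ring
  rw [hexp] at htail
  -- the tail: `Ct · L · [(q̂^{Δ'})² q̂⁴ (q̂²/Y)^{(6+δ)/η}/(qr)] ≤ Ct · (Cl q̂) · q̂⁻¹ q̂^{-δ}/r = Ct Cl q̂^{-δ}/r`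
  have htail' : ‖∑ d₁ ∈ Icc 1 ⌊KMV2000.qhat q ^ Δ'⌋₊, ∑ d₂ ∈ Icc 1 ⌊KMV2000.qhat q ^ Δ'⌋₊,
      ∑ m₁ ∈ Icc 1 (⌊KMV2000.qhat q ^ Δ'⌋₊ / d₁), ∑ n₁ ∈ Icc 1 (q ^ 2 / d₁),
      ∑ m₂ ∈ Icc 1 (⌊KMV2000.qhat q ^ Δ'⌋₊ / d₂),
      ∑ n₂ ∈ (Icc 1 (q ^ 2 / d₂)).filter (fun n₂ ↦ Y < d₁ * n₁ * (d₂ * n₂)),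
        ((((((d₁ * n₁ : ℕ) : ℝ) * ((d₂ * n₂ : ℕ) : ℝ)) ^ (-(1 / 2 : ℝ)) : ℝ) : ℂ) *
            afeW (KMV2000.qhat q) i j (d₁ * n₁) (d₂ * n₂)) *
          ((KMV2000.mollifierCoeff P (KMV2000.qhat q ^ Δ') (d₁ * m₁) : ℂ) *
            (KMV2000.mollifierCoeff P (KMV2000.qhat q ^ Δ') (d₂ * m₂) : ℂ) *
            layerKernel q r (m₁ * n₁) (m₂ * n₂))‖ ≤
      Ct * Cl * KMV2000.qhat q ^ (-δ) * ((r : ℝ))⁻¹ := by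
    refine htail.trans ?_
    have e1 : Ct * ((1 + Real.log (KMV2000.qhat q)) * (1 + 2 * Real.log q)) ^ (i + j) * (KMV2000.qhat q ^ Δ') ^ 2 *
          KMV2000.qhat q ^ 4 * (KMV2000.qhat q ^ 2 / (Y : ℝ)) ^ ((6 + δ) / η) / ((q : ℝ) * r) =
        Ct * ((1 + Real.log (KMV2000.qhat q)) * (1 + 2 * Real.log q)) ^ (i + j) *
          ((KMV2000.qhat q ^ Δ') ^ 2 * KMV2000.qhat q ^ 4 * (KMV2000.qhat q ^ 2 / (Y : ℝ)) ^ ((6 + δ) / η) /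
            ((q : ℝ) * r)) := by ring
    rw [e1]
    have hL0 : 0 ≤ ((1 + Real.log (KMV2000.qhat q)) * (1 + 2 * Real.log q)) ^ (i + j) := by
      refine pow_nonneg (mul_nonneg ?_ ?_) _
      · linarith [Real.log_nonneg hqh1.le]
      · have : (1 : ℝ) ≤ q := by exact_mod_cast (le_trans (by norm_num) h64 : 1 ≤ q)
        linarith [Real.log_nonneg this]
    have hS0 : 0 ≤ KMV2000.qhat q ^ (-1 : ℝ) * KMV2000.qhat q ^ (-δ) * ((r : ℝ))⁻¹ := by positivity
    calc Ct * ((1 + Real.log (KMV2000.qhat q)) * (1 + 2 * Real.log q)) ^ (i + j) *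
          ((KMV2000.qhat q ^ Δ') ^ 2 * KMV2000.qhat q ^ 4 * (KMV2000.qhat q ^ 2 / (Y : ℝ)) ^ ((6 + δ) / η) /
            ((q : ℝ) * r))
        ≤ Ct * (Cl * KMV2000.qhat q) * (KMV2000.qhat q ^ (-1 : ℝ) * KMV2000.qhat q ^ (-δ) * ((r : ℝ))⁻¹) := by
          refine mul_le_mul (mul_le_mul_of_nonneg_left hlog hCt0) hscale ?_ (mul_nonneg hCt0 (by positivity))
          exact div_nonneg (mul_nonneg (by positivity) (Real.rpow_nonneg (by positivity) _)) (by positivity)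
      _ = Ct * Cl * (KMV2000.qhat q * KMV2000.qhat q ^ (-1 : ℝ)) * KMV2000.qhat q ^ (-δ) * ((r : ℝ))⁻¹ := by ring
      _ = Ct * Cl * KMV2000.qhat q ^ (-δ) * ((r : ℝ))⁻¹ := by
          rw [Real.rpow_neg_one, mul_inv_cancel₀ hqh0.ne', mul_one]
  calc _ ≤ A * KMV2000.qhat q ^ (-δ) * ((r : ℝ))⁻¹ + Ct * Cl * KMV2000.qhat q ^ (-δ) * ((r : ℝ))⁻¹ :=
        add_le_add hmain htail'
    _ = (A + Ct * Cl) * KMV2000.qhat q ^ (-δ) * ((r : ℝ))⁻¹ := by ring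

end Summit.Parity.GeneralizedHardyLittlewood.Theorems.MomentsBeyondDiagonal.Layers

end
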